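import Summits.Ventures.Crystal3D.Theorems.StickyWulffConstantCoaxialWallLawKissingCageLocal
import HarnessLib

/-!
# Lens capacity: an adjacent-divacancy lens holds at most TWO unit balls (crux `CoaxialWallLaw`, stmt-Ventures-19481)

HONEST FRAMING. Venture `Summits/Ventures/Crystal3D` (cell `crystal3d-full`); helper `--supports` the crux `CoaxialWallLaw`
(stmt-Ventures-19481, `route-Ventures-StickyWulffConstant`), registered line 'CoaxialWallLawCertificates' (planner cf-p1).  Census-free
geometry; F-C1 not moved.  cf-p1 DECISION (cxxiv): `lens_capacity_two` is the declared dependency (LENSCAP) of cf-p2's PREREG (69.0⁵) L2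
(finiteness of the loose-filler enumeration for `TailResidue.LensCert`); memo HOME/wall-19481-p2/F-TAIL-g9.md §10.

THE LENS of an adjacent slot pair `(a, b)` (`‖a‖ = ‖b‖ = 1`, `⟪a, b⟫ = ½`) at a host `y` is the set of contacts `x` of `y` (`dist x y = 1`)
that strictly block both slots (`½ < ⟪x − y, a⟫`, `½ < ⟪x − y, b⟫`, i.e. `dist x (y + a) < 1`, `dist x (y + b) < 1`) — by the divacancy law
(`foreign_contact_adjacent_divacancy`) every off-frame contact of a framed host lies in such a lens.  Results (all in `E³`):
* `apex_side_coeffs`, `reuleaux_coeffs` — the two real-arithmetic cores;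
* `inner_apex_gt_half` — a lens direction on the closed side of an APEX `T` (the fourth vertex of the regular tetrahedron on `0, a, b`)
  is within `60°` of `T` (strictly);
* `inner_gt_half_of_reuleaux` — two unit vectors in the open spherical Reuleaux triangle of `a, b, T` are within `60°` (strictly);
* **`inner_gt_half_of_lens_same_side`** — two lens directions on the same closed side of the host plane `span{a, b}` are within `60°`
  strictly, i.e. two balls of one lens that are `≥ 1` apart lie on OPPOSITE sides of the host triangle's plane;
* **`lens_capacity_two`** — three pairwise `≥ 1`-separated balls in one lens are impossible; `lens_capacity_two_slots` — the same for the
  slots `G v, G n` (`⟪n, v⟫ = ½`) of any frame `G`.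
Proof: decompose in the basis `(a, b, T)` of `E³` (Gram matrix `½` off the diagonal); the sign of the normal component is the sign of the
`T`-coefficient; on `T`'s side the lens lies in the `60°`-cap of `T`; in the Reuleaux triangle at most one coefficient is negative and the
three cap constraints give `⟪u, u'⟫ > ½` case by case.  (Three dimensions are essential: the statement fails in `E⁴`.)
WHAT THIS IS NOT: no statement about types, certificates or packings beyond three balls; F-C1 not moved.
-/

noncomputable section

namespace Summit.Ventures.Crystal3D.Theorems

namespace LensCapacity

open Summit.Ventures.Crystal3D Module
open scoped InnerProductSpace


/-! ### Real-arithmetic cores -/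

/-- **Step 1 in coefficients.**  For `u = l•a + m•b + n•T` (`a, b, T` unit, pairwise inner products `½`, so `‖u‖² = l²+m²+n²+lm+ln+mn`):
if `⟪u, a⟫, ⟪u, b⟫ > ½` and `n ≥ 0` then `⟪u, T⟫ = l/2 + m/2 + n > ½`. -/
theorem apex_side_coeffs {l m n : ℝ} (h1 : 1 / 2 < l + m / 2 + n / 2) (h2 : 1 / 2 < l / 2 + m + n / 2) (hn : 0 ≤ n)
    (hQ : l ^ 2 + m ^ 2 + n ^ 2 + l * m + l * n + m * n = 1) : 1 / 2 < l / 2 + m / 2 + n := by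
  by_contra h
  push Not at h
  have hE : 0 < 3 * (l + m) + 2 * n - 2 := by linarith
  have hn4 : 0 ≤ 4 - n := by linarith
  -- certificate: 4·(h1-gap)(h2-gap) + (Q − 1) + c·E + (4/3)·n·E + 2c + (2/3)·n·(4 − n) ≡ 0 with c = 1 − (l+m) − 2n ≥ 0
  nlinarith [mul_pos (sub_pos.2 h1) (sub_pos.2 h2), mul_nonneg (sub_nonneg.2 h) hE.le, mul_nonneg hn hE.le, mul_nonneg hn hn4]

/-- **Reuleaux in coefficients.**  With `pa = ⟪u, a⟫`, `pb = ⟪u, b⟫`, `pt = ⟪u, T⟫ ∈ (½, 1]` and `u' = l•a + m•b + n•T` unit lying in the three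
open `60°`-caps of `a, b, T`: `⟪u, u'⟫ = l·pa + m·pb + n·pt > ½`.  (At most one coefficient is negative; for it the cap of its own
vertex pays.) -/
theorem reuleaux_coeffs {pa pb pt l m n : ℝ} (ha : 1 / 2 < pa) (ha' : pa ≤ 1) (hb : 1 / 2 < pb) (hb' : pb ≤ 1)
    (ht : 1 / 2 < pt) (ht' : pt ≤ 1) (h1 : 1 / 2 < l + m / 2 + n / 2) (h2 : 1 / 2 < l / 2 + m + n / 2)
    (h3 : 1 / 2 < l / 2 + m / 2 + n) (hQ : l ^ 2 + m ^ 2 + n ^ 2 + l * m + l * n + m * n = 1) :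
    1 / 2 < l * pa + m * pb + n * pt := by
  rcases le_or_gt 0 l with hl | hl <;> rcases le_or_gt 0 m with hm | hm <;> rcases le_or_gt 0 n with hn | hn
  · -- all coefficients nonnegative: `l + m + n ≥ 1`, and one of them is `≥ 1/3`
    have hs : 1 ≤ l + m + n := by nlinarith [mul_nonneg hl hm, mul_nonneg hl hn, mul_nonneg hm hn]
    rcases le_or_gt (1 / 3) l with hl3 | hl3
    · nlinarith [mul_nonneg (sub_nonneg.2 hl3) (sub_pos.2 ha).le, mul_nonneg hm (sub_pos.2 hb).le, mul_nonneg hn (sub_pos.2 ht).le]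
    rcases le_or_gt (1 / 3) m with hm3 | hm3
    · nlinarith [mul_nonneg (sub_nonneg.2 hm3) (sub_pos.2 hb).le, mul_nonneg hl (sub_pos.2 ha).le, mul_nonneg hn (sub_pos.2 ht).le]
    have hn3 : 1 / 3 ≤ n := by linarith
    nlinarith [mul_nonneg (sub_nonneg.2 hn3) (sub_pos.2 ht).le, mul_nonneg hl (sub_pos.2 ha).le, mul_nonneg hm (sub_pos.2 hb).le]
  · -- only `n < 0`: the `T`-cap pays
    nlinarith [mul_nonneg hl (sub_pos.2 ha).le, mul_nonneg hm (sub_pos.2 hb).le, mul_nonneg (neg_nonneg.2 hn.le) (sub_nonneg.2 ht')]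
  · -- only `m < 0`
    nlinarith [mul_nonneg hl (sub_pos.2 ha).le, mul_nonneg hn (sub_pos.2 ht).le, mul_nonneg (neg_nonneg.2 hm.le) (sub_nonneg.2 hb')]
  · -- `m, n < 0`: impossible
    exfalso
    have hl1 : 0 < l - 1 := by linarith
    have hS : 0 < l + m + n - 1 := by linarith
    nlinarith [mul_pos hl1 hS, sq_nonneg (m + n / 2), sq_nonneg n]
  · -- only `l < 0`
    nlinarith [mul_nonneg hm (sub_pos.2 hb).le, mul_nonneg hn (sub_pos.2 ht).le, mul_nonneg (neg_nonneg.2 hl.le) (sub_nonneg.2 ha')]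
  · exfalso
    have hm1 : 0 < m - 1 := by linarith
    have hS : 0 < l + m + n - 1 := by linarith
    nlinarith [mul_pos hm1 hS, sq_nonneg (l + n / 2), sq_nonneg n]
  · exfalso
    have hn1 : 0 < n - 1 := by linarith
    have hS : 0 < l + m + n - 1 := by linarith
    nlinarith [mul_pos hn1 hS, sq_nonneg (l + m / 2), sq_nonneg m]
  · exfalso; linarith

/-! ### The tetrahedral frame `(a, b, T)` in `E³` -/

section Frame

variable {a b T : (EuclideanSpace ℝ (Fin 3))} (ha : ‖a‖ = 1) (hb : ‖b‖ = 1) (hT : ‖T‖ = 1)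
  (hab : ⟪a, b⟫_ℝ = 1 / 2) (haT : ⟪a, T⟫_ℝ = 1 / 2) (hbT : ⟪b, T⟫_ℝ = 1 / 2)

include ha hb hT hab haT hbT

/-- Inner products of a combination `l•a + m•b + n•T` with the three vertices and with itself. -/
theorem inner_combo (l m n : ℝ) :
    ⟪l • a + m • b + n • T, a⟫_ℝ = l + m / 2 + n / 2 ∧ ⟪l • a + m • b + n • T, b⟫_ℝ = l / 2 + m + n / 2 ∧
      ⟪l • a + m • b + n • T, T⟫_ℝ = l / 2 + m / 2 + n ∧
      ‖l • a + m • b + n • T‖ ^ 2 = l ^ 2 + m ^ 2 + n ^ 2 + l * m + l * n + m * n := by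
  have haa : ⟪a, a⟫_ℝ = 1 := by rw [real_inner_self_eq_norm_sq, ha]; norm_num
  have hbb : ⟪b, b⟫_ℝ = 1 := by rw [real_inner_self_eq_norm_sq, hb]; norm_num
  have hTT : ⟪T, T⟫_ℝ = 1 := by rw [real_inner_self_eq_norm_sq, hT]; norm_num
  have hba : ⟪b, a⟫_ℝ = 1 / 2 := by rw [real_inner_comm]; exact hab
  have hTa : ⟪T, a⟫_ℝ = 1 / 2 := by rw [real_inner_comm]; exact haT
  have hTb : ⟪T, b⟫_ℝ = 1 / 2 := by rw [real_inner_comm]; exact hbT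
  refine ⟨?_, ?_, ?_, ?_⟩
  · simp only [inner_add_left, real_inner_smul_left, haa, hba, hTa]; ring
  · simp only [inner_add_left, real_inner_smul_left, hab, hbb, hTb]; ring
  · simp only [inner_add_left, real_inner_smul_left, haT, hbT, hTT]; ring
  · rw [← real_inner_self_eq_norm_sq]
    simp only [inner_add_left, inner_add_right, real_inner_smul_left, real_inner_smul_right, haa, hbb, hTT, hab, hba, haT, hTa,
      hbT, hTb]
    ring

/-- `a, b, T` are linearly independent (their Gram matrix is invertible). -/
theorem linearIndependent_frame : LinearIndependent ℝ ![a, b, T] := by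
  rw [Fintype.linearIndependent_iff]
  intro g hg
  have hsum : ∑ i, g i • ![a, b, T] i = g 0 • a + g 1 • b + g 2 • T := by
    simp [Fin.sum_univ_three]
  rw [hsum] at hg
  obtain ⟨h1, h2, h3, -⟩ := inner_combo ha hb hT hab haT hbT (g 0) (g 1) (g 2)
  rw [hg, inner_zero_left] at h1 h2 h3
  intro i
  fin_cases i <;> simp <;> linarith

/-- **Three dimensions**: every vector of `E³` is a combination of `a, b, T`. -/
theorem exists_coeffs (u : (EuclideanSpace ℝ (Fin 3))) : ∃ l m n : ℝ, u = l • a + m • b + n • T := by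
  have hli := linearIndependent_frame ha hb hT hab haT hbT
  have hcard : Fintype.card (Fin 3) = finrank ℝ (EuclideanSpace ℝ (Fin 3)) := by simp
  have htop := hli.span_eq_top_of_card_eq_finrank hcard
  have hu : u ∈ Submodule.span ℝ (Set.range ![a, b, T]) := by rw [htop]; exact Submodule.mem_top
  obtain ⟨c, hc⟩ := (Submodule.mem_span_range_iff_exists_fun ℝ).1 hu
  refine ⟨c 0, c 1, c 2, ?_⟩
  rw [← hc]
  simp [Fin.sum_univ_three]

/-- **Step 1.**  A unit vector in the open lens of `(a, b)` whose `T`-coefficient is nonnegative is strictly within `60°` of `T`. -/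
theorem inner_apex_gt_half {l m n : ℝ} (hu : ‖l • a + m • b + n • T‖ = 1) (hua : 1 / 2 < ⟪l • a + m • b + n • T, a⟫_ℝ)
    (hub : 1 / 2 < ⟪l • a + m • b + n • T, b⟫_ℝ) (hn : 0 ≤ n) : 1 / 2 < ⟪l • a + m • b + n • T, T⟫_ℝ := by
  obtain ⟨h1, h2, h3, h4⟩ := inner_combo ha hb hT hab haT hbT l m n
  rw [h1] at hua; rw [h2] at hub; rw [h3]
  rw [hu] at h4
  exact apex_side_coeffs hua hub hn (by linarith [h4])

/-- **Step 2 (spherical Reuleaux triangle).**  `u` unit in the open caps of `a, b, T`; `u'` unit (given by coefficients) in the same three open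
caps; then `⟪u, u'⟫ > ½`. -/
theorem inner_gt_half_of_reuleaux {u : (EuclideanSpace ℝ (Fin 3))} (hu : ‖u‖ = 1) (hua : 1 / 2 < ⟪u, a⟫_ℝ) (hub : 1 / 2 < ⟪u, b⟫_ℝ) (huT : 1 / 2 < ⟪u, T⟫_ℝ)
    {l m n : ℝ} (hu' : ‖l • a + m • b + n • T‖ = 1) (hua' : 1 / 2 < ⟪l • a + m • b + n • T, a⟫_ℝ)
    (hub' : 1 / 2 < ⟪l • a + m • b + n • T, b⟫_ℝ) (huT' : 1 / 2 < ⟪l • a + m • b + n • T, T⟫_ℝ) :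
    1 / 2 < ⟪u, l • a + m • b + n • T⟫_ℝ := by
  obtain ⟨h1, h2, h3, h4⟩ := inner_combo ha hb hT hab haT hbT l m n
  rw [h1] at hua'; rw [h2] at hub'; rw [h3] at huT'; rw [hu'] at h4
  have hexp : ⟪u, l • a + m • b + n • T⟫_ℝ = l * ⟪u, a⟫_ℝ + m * ⟪u, b⟫_ℝ + n * ⟪u, T⟫_ℝ := by
    simp only [inner_add_right, real_inner_smul_right]
  rw [hexp]
  have ha' : ⟪u, a⟫_ℝ ≤ 1 := by have := real_inner_le_norm u a; rw [hu, ha] at this; linarith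
  have hb' : ⟪u, b⟫_ℝ ≤ 1 := by have := real_inner_le_norm u b; rw [hu, hb] at this; linarith
  have hT' : ⟪u, T⟫_ℝ ≤ 1 := by have := real_inner_le_norm u T; rw [hu, hT] at this; linarith
  exact reuleaux_coeffs hua ha' hub hb' huT hT' hua' hub' huT' (by linarith [h4])

/-- Steps 1 + 2 on `T`'s side: two unit vectors in the open lens of `(a, b)` with nonnegative `T`-coefficients are within `60°`. -/
theorem inner_gt_half_of_coeffs {l m n l' m' n' : ℝ} (hu : ‖l • a + m • b + n • T‖ = 1)
    (hua : 1 / 2 < ⟪l • a + m • b + n • T, a⟫_ℝ) (hub : 1 / 2 < ⟪l • a + m • b + n • T, b⟫_ℝ) (hn : 0 ≤ n)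
    (hu' : ‖l' • a + m' • b + n' • T‖ = 1) (hua' : 1 / 2 < ⟪l' • a + m' • b + n' • T, a⟫_ℝ)
    (hub' : 1 / 2 < ⟪l' • a + m' • b + n' • T, b⟫_ℝ) (hn' : 0 ≤ n') :
    1 / 2 < ⟪l • a + m • b + n • T, l' • a + m' • b + n' • T⟫_ℝ :=
  inner_gt_half_of_reuleaux ha hb hT hab haT hbT hu hua hub (inner_apex_gt_half ha hb hT hab haT hbT hu hua hub hn) hu' hua' hub'
    (inner_apex_gt_half ha hb hT hab haT hbT hu' hua' hub' hn')

end Frame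

/-! ### The apex over a lens and the main theorems -/

/-- The APEX over the lens: for `w` orthogonal to the unit pair `a, b` (`⟪a, b⟫ = ½`) and `κ² ‖w‖² = 2/3`, the vector
`T = (a + b)/3 + κ w` is a unit vector at `60°` from `a` and `b` with `⟪w, T⟫ = κ ‖w‖²`. -/
theorem apex_facts {a b w : (EuclideanSpace ℝ (Fin 3))} (ha : ‖a‖ = 1) (hb : ‖b‖ = 1) (hab : ⟪a, b⟫_ℝ = 1 / 2) (hwa : ⟪w, a⟫_ℝ = 0) (hwb : ⟪w, b⟫_ℝ = 0)
    {κ : ℝ} (hκ : κ ^ 2 * ‖w‖ ^ 2 = 2 / 3) :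
    ‖(1 / 3 : ℝ) • a + (1 / 3 : ℝ) • b + κ • w‖ = 1 ∧ ⟪a, (1 / 3 : ℝ) • a + (1 / 3 : ℝ) • b + κ • w⟫_ℝ = 1 / 2 ∧
      ⟪b, (1 / 3 : ℝ) • a + (1 / 3 : ℝ) • b + κ • w⟫_ℝ = 1 / 2 ∧ ⟪w, (1 / 3 : ℝ) • a + (1 / 3 : ℝ) • b + κ • w⟫_ℝ = κ * ‖w‖ ^ 2 := by
  have haa : ⟪a, a⟫_ℝ = 1 := by rw [real_inner_self_eq_norm_sq, ha]; norm_num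
  have hbb : ⟪b, b⟫_ℝ = 1 := by rw [real_inner_self_eq_norm_sq, hb]; norm_num
  have hww : ⟪w, w⟫_ℝ = ‖w‖ ^ 2 := real_inner_self_eq_norm_sq w
  have hba : ⟪b, a⟫_ℝ = 1 / 2 := by rw [real_inner_comm]; exact hab
  have haw : ⟪a, w⟫_ℝ = 0 := by rw [real_inner_comm]; exact hwa
  have hbw : ⟪b, w⟫_ℝ = 0 := by rw [real_inner_comm]; exact hwb
  have hTT : ⟪(1 / 3 : ℝ) • a + (1 / 3 : ℝ) • b + κ • w, (1 / 3 : ℝ) • a + (1 / 3 : ℝ) • b + κ • w⟫_ℝ = 1 := by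
    simp only [inner_add_left, inner_add_right, real_inner_smul_left, real_inner_smul_right, haa, hbb, hab, hba, haw, hbw, hwa,
      hwb, hww]
    linear_combination hκ
  refine ⟨?_, ?_, ?_, ?_⟩
  · rw [real_inner_self_eq_norm_sq] at hTT
    have h0 : 0 ≤ ‖(1 / 3 : ℝ) • a + (1 / 3 : ℝ) • b + κ • w‖ := norm_nonneg _
    nlinarith [hTT, h0]
  · simp only [inner_add_right, real_inner_smul_right, haa, hab, haw]; ring
  · simp only [inner_add_right, real_inner_smul_right, hba, hbb, hbw]; ring
  · simp only [inner_add_right, real_inner_smul_right, hwa, hwb, hww]; ring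

/-- **TWO BALLS OF ONE LENS LIE ON OPPOSITE SIDES OF THE HOST PLANE.**  `a, b` unit with `⟪a, b⟫ = ½`; `w ≠ 0` orthogonal to both (a normal
of the host triangle's plane); `u, u'` unit in the open lens (`⟪·, a⟫, ⟪·, b⟫ > ½`) on the same closed side (`⟪u, w⟫·⟪u', w⟫ ≥ 0`).
Then `⟪u, u'⟫ > ½`, i.e. `dist u u' < 1`. -/
theorem inner_gt_half_of_lens_same_side {a b w u u' : (EuclideanSpace ℝ (Fin 3))} (ha : ‖a‖ = 1) (hb : ‖b‖ = 1) (hab : ⟪a, b⟫_ℝ = 1 / 2)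
    (hw : w ≠ 0) (hwa : ⟪w, a⟫_ℝ = 0) (hwb : ⟪w, b⟫_ℝ = 0)
    (hu : ‖u‖ = 1) (hua : 1 / 2 < ⟪u, a⟫_ℝ) (hub : 1 / 2 < ⟪u, b⟫_ℝ)
    (hu' : ‖u'‖ = 1) (hua' : 1 / 2 < ⟪u', a⟫_ℝ) (hub' : 1 / 2 < ⟪u', b⟫_ℝ) (hside : 0 ≤ ⟪u, w⟫_ℝ * ⟪u', w⟫_ℝ) :
    1 / 2 < ⟪u, u'⟫_ℝ := by
  -- a common sign `s = ±1` with `s⟪u, w⟫ ≥ 0`, `s⟪u', w⟫ ≥ 0`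
  obtain ⟨s, hs, hsu, hsu'⟩ : ∃ s : ℝ, s ^ 2 = 1 ∧ 0 ≤ s * ⟪u, w⟫_ℝ ∧ 0 ≤ s * ⟪u', w⟫_ℝ := by
    rcases lt_trichotomy 0 ⟪u, w⟫_ℝ with h | h | h
    · refine ⟨1, by norm_num, by linarith, ?_⟩
      rw [one_mul]; by_contra h'; push Not at h'
      have := mul_neg_of_pos_of_neg h h'
      linarith
    · rcases le_total 0 ⟪u', w⟫_ℝ with h' | h'
      · exact ⟨1, by norm_num, by rw [← h]; norm_num, by linarith⟩
      · exact ⟨-1, by norm_num, by rw [← h]; norm_num, by linarith⟩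
    · refine ⟨-1, by norm_num, by linarith, ?_⟩
      by_contra h'; push Not at h'
      have := mul_neg_of_neg_of_pos h (by linarith : 0 < ⟪u', w⟫_ℝ)
      linarith
  -- the apex on that side: T = (a + b)/3 + (s c) • w with (s c)² ‖w‖² = 2/3
  have hwn : 0 < ‖w‖ := norm_pos_iff.2 hw
  set c : ℝ := Real.sqrt (2 / 3) / ‖w‖ with hc
  have hc2 : c ^ 2 * ‖w‖ ^ 2 = 2 / 3 := by
    rw [hc, div_pow, Real.sq_sqrt (by norm_num)]; field_simp
  have hcpos : 0 < c := by rw [hc]; exact div_pos (Real.sqrt_pos.2 (by norm_num)) hwn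
  have hcw : 0 < c * ‖w‖ ^ 2 := by positivity
  have hκ : (s * c) ^ 2 * ‖w‖ ^ 2 = 2 / 3 := by rw [mul_pow, hs, one_mul]; exact hc2
  obtain ⟨hT, haT, hbT, hwT⟩ := apex_facts ha hb hab hwa hwb hκ
  set T : (EuclideanSpace ℝ (Fin 3)) := (1 / 3 : ℝ) • a + (1 / 3 : ℝ) • b + (s * c) • w with hTdef
  have haw : ⟪a, w⟫_ℝ = 0 := by rw [real_inner_comm]; exact hwa
  have hbw : ⟪b, w⟫_ℝ = 0 := by rw [real_inner_comm]; exact hwb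
  -- decompose `u, u'` in the basis `(a, b, T)`; the `T`-coefficients are nonnegative
  obtain ⟨l, m, n, rfl⟩ := exists_coeffs ha hb hT hab haT hbT u
  obtain ⟨l', m', n', rfl⟩ := exists_coeffs ha hb hT hab haT hbT u'
  have e : ∀ l m n : ℝ, s * ⟪l • a + m • b + n • T, w⟫_ℝ = n * (c * ‖w‖ ^ 2) * s ^ 2 := by
    intro l m n
    simp only [inner_add_left, real_inner_smul_left, haw, hbw]
    rw [real_inner_comm, hwT]; ring
  have hn : 0 ≤ n := by
    rw [e, hs, mul_one] at hsu
    exact le_of_mul_le_mul_right (by rwa [zero_mul]) hcw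
  have hn' : 0 ≤ n' := by
    rw [e, hs, mul_one] at hsu'
    exact le_of_mul_le_mul_right (by rwa [zero_mul]) hcw
  exact inner_gt_half_of_coeffs ha hb hT hab haT hbT hu hua hub hn hu' hua' hub' hn'

/-- Distances and inner products: `dist x (y + a) < 1` for a unit `a` and a contact `x` of `y` means `½ < ⟪x − y, a⟫`. -/
theorem half_lt_inner_of_dist_lt_one {x y a : (EuclideanSpace ℝ (Fin 3))} (hxy : dist x y = 1) (ha : ‖a‖ = 1) (h : dist x (y + a) < 1) :
    1 / 2 < ⟪x - y, a⟫_ℝ := by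
  have h1 : ‖x - y‖ = 1 := by rwa [← dist_eq_norm]
  have h2 : ‖x - y - a‖ < 1 := by rwa [dist_eq_norm, show x - (y + a) = x - y - a by abel] at h
  have h3 : ‖x - y - a‖ ^ 2 = 2 - 2 * ⟪x - y, a⟫_ℝ := by rw [norm_sub_sq_real, h1, ha]; ring
  have h4 : ‖x - y - a‖ ^ 2 < 1 := by nlinarith [norm_nonneg (x - y - a)]
  linarith

/-- **Existence of a plane normal in `E³`**: for nonzero `a, b` there is `w ≠ 0` orthogonal to both (dimension count). -/
theorem exists_normal {a b : (EuclideanSpace ℝ (Fin 3))} (ha0 : a ≠ 0) (hb0 : b ≠ 0) : ∃ w : (EuclideanSpace ℝ (Fin 3)), w ≠ 0 ∧ ⟪w, a⟫_ℝ = 0 ∧ ⟪w, b⟫_ℝ = 0 := by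
  set K : Submodule ℝ (EuclideanSpace ℝ (Fin 3)) := (ℝ ∙ a) ⊔ (ℝ ∙ b) with hK
  have hK2 : finrank ℝ K ≤ 2 := by
    have h := Submodule.finrank_add_le_finrank_add_finrank (ℝ ∙ a) (ℝ ∙ b)
    rw [finrank_span_singleton ha0, finrank_span_singleton hb0] at h
    exact h
  have hE : finrank ℝ (EuclideanSpace ℝ (Fin 3)) = 3 := by simp
  have hsum := Submodule.finrank_add_finrank_orthogonal K
  have hKo : Kᗮ ≠ ⊥ := by
    intro h
    have h0 : finrank ℝ Kᗮ = 0 := by rw [h]; simp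
    omega
  obtain ⟨w, hw, hw0⟩ := Submodule.exists_mem_ne_zero_of_ne_bot hKo
  refine ⟨w, hw0, ?_, ?_⟩
  · rw [real_inner_comm]
    exact Submodule.inner_right_of_mem_orthogonal (Submodule.mem_sup_left (Submodule.mem_span_singleton_self a)) hw
  · rw [real_inner_comm]
    exact Submodule.inner_right_of_mem_orthogonal (Submodule.mem_sup_right (Submodule.mem_span_singleton_self b)) hw

/-- Two lens balls at distance `≥ 1` lie on STRICTLY opposite sides of the host plane (contrapositive of
`inner_gt_half_of_lens_same_side`, in ball language). -/
theorem lens_pair_opposite_sides {a b w y x x' : (EuclideanSpace ℝ (Fin 3))} (ha : ‖a‖ = 1) (hb : ‖b‖ = 1) (hab : ⟪a, b⟫_ℝ = 1 / 2)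
    (hw : w ≠ 0) (hwa : ⟪w, a⟫_ℝ = 0) (hwb : ⟪w, b⟫_ℝ = 0)
    (hx : dist x y = 1) (hxa : 1 / 2 < ⟪x - y, a⟫_ℝ) (hxb : 1 / 2 < ⟪x - y, b⟫_ℝ)
    (hx' : dist x' y = 1) (hxa' : 1 / 2 < ⟪x' - y, a⟫_ℝ) (hxb' : 1 / 2 < ⟪x' - y, b⟫_ℝ) (hsep : 1 ≤ dist x x') :
    ⟪x - y, w⟫_ℝ * ⟪x' - y, w⟫_ℝ < 0 := by
  by_contra hs
  push Not at hs
  have hu : ‖x - y‖ = 1 := by rwa [← dist_eq_norm]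
  have hu' : ‖x' - y‖ = 1 := by rwa [← dist_eq_norm]
  have h := inner_gt_half_of_lens_same_side ha hb hab hw hwa hwb hu hxa hxb hu' hxa' hxb' hs
  have hd : dist x x' ^ 2 < 1 := by
    rw [dist_eq_norm, show x - x' = (x - y) - (x' - y) by abel, norm_sub_sq_real, hu, hu']; linarith
  nlinarith [dist_nonneg (x := x) (y := x')]

/-- **LENS CAPACITY TWO.**  `a, b` unit with `⟪a, b⟫ = ½` (an adjacent slot pair of a host `y`); three contacts `x₁, x₂, x₃` of `y` each
strictly blocking both slots `y + a`, `y + b` cannot be pairwise `≥ 1` apart. -/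
theorem lens_capacity_two {a b y x₁ x₂ x₃ : (EuclideanSpace ℝ (Fin 3))} (ha : ‖a‖ = 1) (hb : ‖b‖ = 1) (hab : ⟪a, b⟫_ℝ = 1 / 2)
    (h₁ : dist x₁ y = 1) (h₂ : dist x₂ y = 1) (h₃ : dist x₃ y = 1)
    (h₁a : 1 / 2 < ⟪x₁ - y, a⟫_ℝ) (h₁b : 1 / 2 < ⟪x₁ - y, b⟫_ℝ) (h₂a : 1 / 2 < ⟪x₂ - y, a⟫_ℝ) (h₂b : 1 / 2 < ⟪x₂ - y, b⟫_ℝ)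
    (h₃a : 1 / 2 < ⟪x₃ - y, a⟫_ℝ) (h₃b : 1 / 2 < ⟪x₃ - y, b⟫_ℝ)
    (h₁₂ : 1 ≤ dist x₁ x₂) (h₁₃ : 1 ≤ dist x₁ x₃) (h₂₃ : 1 ≤ dist x₂ x₃) : False := by
  have ha0 : a ≠ 0 := by intro h; rw [h, norm_zero] at ha; norm_num at ha
  have hb0 : b ≠ 0 := by intro h; rw [h, norm_zero] at hb; norm_num at hb
  obtain ⟨w, hw, hwa, hwb⟩ := exists_normal ha0 hb0
  have s12 := lens_pair_opposite_sides ha hb hab hw hwa hwb h₁ h₁a h₁b h₂ h₂a h₂b h₁₂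
  have s13 := lens_pair_opposite_sides ha hb hab hw hwa hwb h₁ h₁a h₁b h₃ h₃a h₃b h₁₃
  have s23 := lens_pair_opposite_sides ha hb hab hw hwa hwb h₂ h₂a h₂b h₃ h₃a h₃b h₂₃
  nlinarith [mul_pos_of_neg_of_neg s12 s13, sq_nonneg ⟪x₁ - y, w⟫_ℝ,
    mul_nonneg (sq_nonneg ⟪x₁ - y, w⟫_ℝ) (neg_nonneg.2 s23.le)]

/-- **LENS CAPACITY TWO, slot form**: for any frame `G` and adjacent slots `v, n` (`⟪n, v⟫ = ½`), three contacts of a host `y` strictly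
blocking both `y + G v` and `y + G n` cannot be pairwise `≥ 1` apart.  (The lens of `foreign_contact_adjacent_divacancy` holds `≤ 2` balls.) -/
theorem lens_capacity_two_slots (G : (EuclideanSpace ℝ (Fin 3)) ≃ₗᵢ[ℝ] (EuclideanSpace ℝ (Fin 3))) {v n : (EuclideanSpace ℝ (Fin 3))} (hv : v ∈ fccSlots) (hn : n ∈ fccSlots) (hvn : ⟪n, v⟫_ℝ = 1 / 2)
    {y x₁ x₂ x₃ : (EuclideanSpace ℝ (Fin 3))} (h₁ : dist x₁ y = 1) (h₂ : dist x₂ y = 1) (h₃ : dist x₃ y = 1)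
    (h₁v : 1 / 2 < ⟪x₁ - y, G v⟫_ℝ) (h₁n : 1 / 2 < ⟪x₁ - y, G n⟫_ℝ) (h₂v : 1 / 2 < ⟪x₂ - y, G v⟫_ℝ) (h₂n : 1 / 2 < ⟪x₂ - y, G n⟫_ℝ)
    (h₃v : 1 / 2 < ⟪x₃ - y, G v⟫_ℝ) (h₃n : 1 / 2 < ⟪x₃ - y, G n⟫_ℝ)
    (h₁₂ : 1 ≤ dist x₁ x₂) (h₁₃ : 1 ≤ dist x₁ x₃) (h₂₃ : 1 ≤ dist x₂ x₃) : False := by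
  have ha : ‖G v‖ = 1 := by rw [LinearIsometryEquiv.norm_map, norm_eq_one_of_mem_fccSlots hv]
  have hb : ‖G n‖ = 1 := by rw [LinearIsometryEquiv.norm_map, norm_eq_one_of_mem_fccSlots hn]
  have hab : ⟪G v, G n⟫_ℝ = 1 / 2 := by rw [LinearIsometryEquiv.inner_map_map, real_inner_comm, hvn]
  exact lens_capacity_two ha hb hab h₁ h₂ h₃ h₁v h₁n h₂v h₂n h₃v h₃n h₁₂ h₁₃ h₂₃

/-- The same with the blocking stated as distances `dist xᵢ (y + G v) < 1`, `dist xᵢ (y + G n) < 1`. -/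
theorem lens_capacity_two_slots_dist (G : (EuclideanSpace ℝ (Fin 3)) ≃ₗᵢ[ℝ] (EuclideanSpace ℝ (Fin 3))) {v n : (EuclideanSpace ℝ (Fin 3))} (hv : v ∈ fccSlots) (hn : n ∈ fccSlots)
    (hvn : ⟪n, v⟫_ℝ = 1 / 2) {y x₁ x₂ x₃ : (EuclideanSpace ℝ (Fin 3))} (h₁ : dist x₁ y = 1) (h₂ : dist x₂ y = 1) (h₃ : dist x₃ y = 1)
    (h₁v : dist x₁ (y + G v) < 1) (h₁n : dist x₁ (y + G n) < 1) (h₂v : dist x₂ (y + G v) < 1) (h₂n : dist x₂ (y + G n) < 1)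
    (h₃v : dist x₃ (y + G v) < 1) (h₃n : dist x₃ (y + G n) < 1)
    (h₁₂ : 1 ≤ dist x₁ x₂) (h₁₃ : 1 ≤ dist x₁ x₃) (h₂₃ : 1 ≤ dist x₂ x₃) : False := by
  have ha : ‖G v‖ = 1 := by rw [LinearIsometryEquiv.norm_map, norm_eq_one_of_mem_fccSlots hv]
  have hb : ‖G n‖ = 1 := by rw [LinearIsometryEquiv.norm_map, norm_eq_one_of_mem_fccSlots hn]
  exact lens_capacity_two_slots G hv hn hvn h₁ h₂ h₃ (half_lt_inner_of_dist_lt_one h₁ ha h₁v)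
    (half_lt_inner_of_dist_lt_one h₁ hb h₁n) (half_lt_inner_of_dist_lt_one h₂ ha h₂v) (half_lt_inner_of_dist_lt_one h₂ hb h₂n)
    (half_lt_inner_of_dist_lt_one h₃ ha h₃v) (half_lt_inner_of_dist_lt_one h₃ hb h₃n) h₁₂ h₁₃ h₂₃

end LensCapacity

end Summit.Ventures.Crystal3D.Theorems

end
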